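import Summits.CriticalPhenomena.PercolationContinuityZ3.Theorems.Transplant.SkelPhiAffinePlacement
import HarnessLib

/-!
# N1 (the `{±1}` node), LEVEL 1, kit adapter file N-K6c′: THE `U`-SCALED RAW SIDE FORM ALONG EITHER BASE AXIS (`rawSideUAx`) — for window
# maps with a raw coordinate `σ(φ_ax − φ_ax(c₀))` along the base axis `ax ∈ {0, 1}` (the root's bridge frame `rootFrame` of (R) has both
# coordinates raw: axis `0` reflected, axis `1` plain); affine of slope `U`, coefficient `U` (`rawSideUAx_isAffine`), so the placement
# lemmas `…_of_affine` and `kitClauseA'` / `kitClauseAHab'` apply verbatim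

builds on p205010 (kernel theorem, internal audit signed; external expert review pending) — nothing in this file uses p205010; nothing here is a
claim about the open node `SamePDropOfSkeletonNeg`.
Lane `prim-bschramm`, seat `prim-bschramm-p1` (gen 11; design KIT-APRON-N1); helper file (`--supports stmt-CriticalPhenomena-4575 --as helper`).
* `axCoef`, **`rawSideUAx`**, `rawSideUAx_isAffine`, `rawSideUAx_lin_sub`.
[cite: KozmaNitzan2024, §4 Lemma 10, p. 20 (Step IV)]
-/

noncomputable section

open scoped Classical

namespace Summit.CriticalPhenomena.PercolationContinuityZ3.Theorems.Transplant

namespace Skelφ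

open Literature.Probability.Percolation Literature.Probability.LatticeModels SimpleGraph
open Literature.Probability.Percolation.KozmaNitzan.Cells (oth oth_ne eq_oth_of_ne oth_oth)

variable {V : Type} {ψ φ : V → Site 2}

/-- The coefficient pair `e·𝟙_{ax}`: `(e, 0)` for `ax = 0`, `(0, e)` for `ax = 1`. [folklore] -/
def axCoef (ax : Fin 2) (e : ℤ) (i : Fin 2) : ℤ := if i = ax then e else 0

/-- `linForm` of `axCoef` reads the coordinate `ax`. [folklore] -/
theorem linForm_axCoef (ax : Fin 2) (e : ℤ) (x : Site 2) : linForm (axCoef ax e 0) (axCoef ax e 1) x = e * x ax := by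
  fin_cases ax <;> simp [linForm, axCoef]

/-- `coef` of `axCoef` along `ax` is `e`, across it is `0`. [folklore] -/
theorem coef_axCoef (ax : Fin 2) (e : ℤ) : coef (axCoef ax e 0) (axCoef ax e 1) ax = e ∧ coef (axCoef ax e 0) (axCoef ax e 1) (oth ax) = 0 := by
  fin_cases ax <;> simp [coef, axCoef, oth]

/-- **The `U`-scaled raw side form along the base axis `ax`**: for a window map whose coordinate `i` is `σ(φ_ax − φ_ax(c₀))`:
`L = −σ₀σU·x_ax`, `θ m = U·(m ∓ face − σ₀σ φ_ax(c₀))`, climbing axis `ax`. [this work] -/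
def rawSideUAx (ψ : V → Site 2) (c₀ : V) (ax : Fin 2) (σ : ℤ) (hσ : σ = 1 ∨ σ = -1) {U : ℤ} (hU : 1 ≤ U) (Lo Hi : Site 2) (i : Fin 2) (σ₀ : ℤˣ)
    (hraw : ∀ w, ψ w i = σ * (φ w ax - φ c₀ ax)) : SideForm ψ φ Lo Hi i σ₀ where
  cα := axCoef ax (-((σ₀ : ℤ) * σ) * U) 0
  cβ := axCoef ax (-((σ₀ : ℤ) * σ) * U) 1
  θ := fun m => (m + (if (σ₀ : ℤ) = 1 then -Hi i else Lo i) - (σ₀ : ℤ) * σ * φ c₀ ax) * U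
  a := ax
  s := -(σ₀ * sgnU σ)
  clim := by
    have hs := val_sgnU hσ
    have h1 : (σ₀ : ℤ) * (σ₀ : ℤ) = 1 := by rcases Int.units_eq_one_or σ₀ with h | h <;> simp [h]
    have h2 : σ * σ = 1 := by rcases hσ with rfl | rfl <;> simp
    rw [(coef_axCoef ax _).1, Units.val_neg, Units.val_mul, hs]
    have e : -((σ₀ : ℤ) * σ) * (-((σ₀ : ℤ) * σ) * U) = ((σ₀ : ℤ) * (σ₀ : ℤ)) * (σ * σ) * U := by ring
    rw [e, h1, h2]; linarith
  depth_iff := by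
    intro v m
    have hx := hraw v
    unfold sdepth
    rw [linForm_axCoef, hx]
    rcases Int.units_eq_one_or σ₀ with h1 | h1 <;> subst h1
    · rw [if_pos Units.val_one, if_pos Units.val_one, Units.val_one]
      constructor
      · intro hh; nlinarith
      · intro hh
        by_contra hc; push Not at hc
        nlinarith
    · have hne : ¬ (((-1 : ℤˣ) : ℤ) = 1) := by simp
      rw [if_neg hne, if_neg hne, Units.val_neg, Units.val_one]
      constructor
      · intro hh; nlinarith
      · intro hh
        by_contra hc; push Not at hc
        nlinarith

/-- The axis raw form is affine of slope `U`, coefficient `U`. [folklore] -/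
theorem rawSideUAx_isAffine (c₀ : V) (ax : Fin 2) (σ : ℤ) (hσ : σ = 1 ∨ σ = -1) {U : ℤ} (hU : 1 ≤ U) (Lo Hi : Site 2) (i : Fin 2) (σ₀ : ℤˣ)
    (hraw : ∀ w, ψ w i = σ * (φ w ax - φ c₀ ax)) : (rawSideUAx ψ c₀ ax σ hσ hU Lo Hi i σ₀ hraw).IsAffine U U := by
  have hs := val_sgnU hσ
  have h1 : (σ₀ : ℤ) * (σ₀ : ℤ) = 1 := by rcases Int.units_eq_one_or σ₀ with h | h <;> simp [h]
  have h2 : σ * σ = 1 := by rcases hσ with rfl | rfl <;> simp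
  have he1 : |(σ₀ : ℤ) * σ| = 1 := by rcases Int.units_eq_one_or σ₀ with h | h <;> rcases hσ with h' | h' <;> simp [h, h']
  refine ⟨fun m m' => by simp only [rawSideUAx]; ring, ?_, ?_, ?_⟩
  · show (((-(σ₀ * sgnU σ)) : ℤˣ) : ℤ) * coef (axCoef ax (-((σ₀ : ℤ) * σ) * U) 0) (axCoef ax (-((σ₀ : ℤ) * σ) * U) 1) ax = U
    rw [(coef_axCoef ax _).1, Units.val_neg, Units.val_mul, hs]; linear_combination U * ((σ * σ) * h1 + h2)
  · show |coef (axCoef ax (-((σ₀ : ℤ) * σ) * U) 0) (axCoef ax (-((σ₀ : ℤ) * σ) * U) 1) (oth ax)| ≤ U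
    rw [(coef_axCoef ax _).2, abs_zero]; linarith
  · rw [SideForm.UL_eq]
    show |axCoef ax (-((σ₀ : ℤ) * σ) * U) 0| + |axCoef ax (-((σ₀ : ℤ) * σ) * U) 1| ≤ U
    have hsσ : |(σ₀ : ℤ)| * |σ| * |U| = U := by rw [← abs_mul, he1, one_mul, abs_of_pos (by linarith)]
    fin_cases ax <;> simp [axCoef] <;> linarith [hsσ]

/-- The axis raw form along a vertex: `L(φ w) − L(φ c) = −σ₀σU·(φ_ax(w) − φ_ax(c))`. [folklore] -/
theorem rawSideUAx_lin_sub (c₀ : V) (ax : Fin 2) (σ : ℤ) (hσ : σ = 1 ∨ σ = -1) {U : ℤ} (hU : 1 ≤ U) (Lo Hi : Site 2) (i : Fin 2) (σ₀ : ℤˣ)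
    (hraw : ∀ w, ψ w i = σ * (φ w ax - φ c₀ ax)) (c w : V) :
    (rawSideUAx ψ c₀ ax σ hσ hU Lo Hi i σ₀ hraw).lin (φ w) - (rawSideUAx ψ c₀ ax σ hσ hU Lo Hi i σ₀ hraw).lin (φ c) =
      -((σ₀ : ℤ) * σ) * U * (φ w ax - φ c ax) := by
  simp only [SideForm.lin, rawSideUAx, linForm_axCoef]; ring

end Skelφ

end Summit.CriticalPhenomena.PercolationContinuityZ3.Theorems.Transplant

end
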